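import Summits.QuantumFields.YangMills.Theorems.BalabanUVNodesN20CutDialElimination
import Literature.MathematicalPhysics.QuantumFieldTheory.Balaban1983to89.Node00.Record13SepCoPHV

/-!
# BalabanUVNodes ∕ N20 (NE7b) — THE CUT DIAL OF K3⁸ STUB 2 IS ELIMINABLE AT THE v6 (SLOT-KEYED) SHAPES: the FOLD PACKAGE once (any witness `(jc, sh, cr)` pinned at live ⇒ a
# folded pair `(sh♯, cr♯)` pinned at the ZERO cut carrying every face transport), and dag-n20-w1's `stubTwoBody_iff_zeroCut` RE-RUN at skeleton v6's stub-2 body — faces N27x ∕ N19′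
# under the binder pair `(h : Provisos₁₃SepCoPH) (v : Revision₁₃ F N θ h)`, prefix (B) ∕ END ∕ `ForSmallCouplings` at `datumOfRecord₁₃SepCoPHV F N θ h v`, readings at `h.toCore`

Cell `pub-ymgap` (HUMAN RULING D-0062 Track A; width push D-0149, director-ym №197), width seat `pub-ymgap-dag-n20-w2` (gen 6) on node N20 = NE7b; key item K3⁸
`SpineGivenEndpointR13SepCoPHV` = stmt-QuantumFields-27366 (dag-lead KEY MAP v2; K3⁷ stmt-QuantumFields-20544 aside); `--kind proof --supports stmt-QuantumFields-27366 --as helper`;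
COUNT-NEUTRAL; LOCATED.  Bus: CLAIM-1 ∕ INTENT-1 (pub-ymgap INBOX l.38627; first refusal to dag-n20-w1, whose g4 ∕ g5 typed the v5 editions).  THEOREMS ONLY; imports dag-n20-w1's
`…N20CutDialElimination` (p606432: the per-tuple budget-free fold AT dag-n20-d's reading of record — `shellWeightBound_crOfRecord₁₃VAt_cutZero_of_faces`,
`coreEdge_crOfRecord₁₃VAt_cutZero_of_coreEdge`, `extraction_crOfRecord₁₃VAt_iff`; through it dag-n19-w1's folds `…N19CutTransferAtSpineReading` and this lineage's ∕ n20-w1's cut-zero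
face `relWeightBound_crOfRecord₁₃VAt_cutZero`) BY NAME; modifies nothing; CONE-FREE (no `Theses` import — the by-name instance at dag-n27-w1's v6 mirror `K3V6Defs` is the sibling file
`…N20CutDialStubTextK3V6`).  [III] = [Balaban1988Convergent], [LF-II] = [Balaban1989LargeFieldII], [I] = [Balaban1987RG1], [King1986] = CMP 102.

WHY.  dag-n20-w1 g4 proved for K3⁷ v5's stub-2 body that the cut dial `jc` is eliminable budget-free (`stubTwoBody_iff_zeroCut`, p606432; by-name at the v5 mirror p614769), and
plan g83 booked it as «v6 input (3)».  Route rev 28∕29 moved the crux to K3⁸ and skeleton v6 (b4e55110ab73e679) KEPT `∃ (jc : CutReading)` while RE-KEYING two of the five conjuncts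
at DEF-1's version slot: `KeyedExtractionV cr` and `KeyedCoreEdgeHolderD4V β cr rr` now read `∀ (h : θ.Provisos₁₃SepCoPH F 2) (v : Revision₁₃ F 2 θ h)`, the prefix
`(B) → END → ForSmallCouplings` and the holder premise AT `datumOfRecord₁₃SepCoPHV F 2 θ h v`, the readings at `h.toCore` (`PinnedAtLive`, `KeyedRelWeight`, `KeyedShellWeight` are
v5's verbatim).  That shape is NOT an instance of p606432 (binder type, datum and premise differ), so the v6 edition is re-run here — with the fold SEPARATED from the shapes:
* §1 ★ `exists_foldedPair` — THE FOLD PACKAGE, generic in `N` and in the live predicate `Live`: from a cut reading `jc`, a split `sh` and a reading `cr` with «`Live F θ →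
  cr F θ hP g₀ os = crOfRecord₁₃V (jc …) sh …`», SOME split `sh♯` (the `jc`-bad keys' whole class weights folded into the shells) and SOME reading `cr♯` (`crOfRecord₁₃V 0 sh♯` ON
  the live line, `cr` OFF it) such that, tuple by tuple: (a) `cr♯` is pinned at the ZERO cut; (b) off the live line `cr♯ = cr`; (c) N20 at `cr♯` holds with NO hypothesis on the live
  line and is inherited from `cr` everywhere; (d) N20 + N21 at `cr` ⇒ N21 at `cr♯` (NO `W + Wsh < 1` budget); (e) the N27x extraction body at `cr` and at `cr♯` is ONE proposition
  for EVERY partition-function letter `Z : ℕ → ℝ → ℝ` (so for the record's AND for every slot datum's Wilson schemes); (f) `∃ δ, Core … δ ∧ Summable δ` at `cr` ⇒ at `cr♯`.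
  Every later dial elimination (v6, (B)-free, a v7 re-key) is (a)–(f) pushed through its own prefix.
* §2 THE v6-SHAPED BODY (spelled out; generic `N`, guard `G`, live predicate `Live`, slot-keyed rates premise `PremV F θ h v g₀ os`): ★★ `exists_zeroCut_of_existsV` · `exists_of_exists_zeroCutV`
  · ★★ `stubTwoBodyV_iff_zeroCut` — «`∃ jc sh cr`, pin ∧ N20 ∧ N21 ∧ N27x(slot) ∧ N19′(slot)» ⟺ the same with the ZERO cut reading.
LOCATED (for plan g86's v7 decision — gapped pin (dag-n21-d V1–V5) or identity pin —, said not decided): at the REGISTERED v6 text the cut dial is the prover's and eliminable; on the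
live line at `jc ≡ 0` the N20 conjunct books nothing (this lineage's g0 p590852 ∕ g5 p633479 for ANY carriers), so under either pin stub 2's two-run content is N21's shell weight,
N27x and the N19′ core edge between the runs' (gapped) cores on EVERY keyed class — the kernel form of g5's diagnosis (`N20-W2-DIAL-INDEX-v4-addendum.md`), now at v6's own shapes.

HONEST FRAMING.  [bookkeeping] over the tree's SHAPES and dag-n20-d's reading BY NAME; an EQUIVALENCE OF TWO HYPOTHESIS SHAPES — neither body is inhabited here, no witness is built
from Bałaban's objects (K3⁸ stubs 1 and 2 OPEN; K0⁷ `Record13SepCoPHInhabited` OPEN); proves NO estimate; nothing of Bałaban's asserted.  NE7 ∕ NE7b ∕ NE7c NOT PRINTED for `d = 4`,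
NOT proved; (α)-instance 0∕1; N19 ∕ N20 ∕ N21 ∕ N27 NOT discharged; K3⁸ NOT closed, NOT claimed; skeleton v6 b4e55110ab73e679 UNTOUCHED (the zero-cut text is NOT registered — plan's
call); K3⁷ aside; counts unmoved (typed 28∕28 · discharged 5∕27); no count claim (the chair's single count line is the only count).  One finite `𝕋⁴_{L^K}` programme at fixed
`ε = L^{−K}`, Bałaban AS PRINTED; the YM mass gap (Clay) is NOT proved by any of this — R4 closes the conditional finite-𝕋⁴ rung `BalabanLadder.UV` only; NOT ℝ⁴, NOT continuum, NOT
OS.  No `def`, no `instance`, no `notation`, no `sorry`.  Sources (location only): [III] (2.18) p.257; [LF-II] Thm 1 + (0.1) pp.355–356, (1.80) p.384; [I] Thm 2 p.259 (the tuned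
prefix); [King1986] (3.10)–(3.13) pp.656–657.
-/

set_option autoImplicit false

noncomputable section

namespace Summit.QuantumFields.YangMills.BalabanUVNodes.N20CutDialFoldSlot

open Literature.MathematicalPhysics.QuantumFieldTheory.Balaban1983to89
open Literature.MathematicalPhysics.QuantumFieldTheory.Balaban1983to89.T4Continuum
open Literature.MathematicalPhysics.QuantumFieldTheory.Balaban1983to89.Node00
open T4WeightBudget (RelWeightBound)
open T4IndicatorShell (ShellWeightBound)
open T4ContinuumYM4Torus (ForSmallCouplings)
open Summit.QuantumFields.BalabanUV.T4Continuum.Spine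
open YMDAG.UVSplit hiding SU
open Summit.QuantumFields.YangMills.BalabanUVNodes.N20ZeroDialFacesAtRecord13CoPHV (relWeightBound_crOfRecord₁₃VAt_cutZero)
open Summit.QuantumFields.YangMills.BalabanUVNodes.N20CutDialElimination
  (shellWeightBound_crOfRecord₁₃VAt_cutZero_of_faces coreEdge_crOfRecord₁₃VAt_cutZero_of_coreEdge extraction_crOfRecord₁₃VAt_iff)

variable {F : T4Family} {N : ℕ} [NeZero N]

/-! ## §1  The fold package — once, for every later prefix -/

section Package

variable (Live : (F : T4Family) → Stage13HParams F N → Prop)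

/-- ★ **THE FOLD PACKAGE** [bookkeeping].  From a cut reading `jc`, a shell split `sh` and a spine reading `cr` PINNED AT LIVE («`Live F θ → cr … = crOfRecord₁₃V (jc …) sh …`») there
are a split `sh♯` — the `jc`-bad keys' whole class weights `weightA₁₃ ∕ weightB₁₃` folded into the shell parts, `sh` off them — and a reading `cr♯` — `crOfRecord₁₃V 0 sh♯` ON the
live line, `cr` OFF it — such that at every tuple `(F, θ, hP, g₀, os)`: (a) `cr♯` is pinned at the ZERO cut; (b) off the live line `cr♯ = cr`; (c) N20 at `cr♯` holds outright on
the live line (the zero cut's bad class is empty — dag-n20-w2 p590852 ∕ dag-n20-w1's V twin) and is inherited from N20 at `cr` at every tuple; (d) N20 + N21 at `cr` ⇒ N21 at `cr♯`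
(dag-n19-w1's budget-free fold, re-canonicalised by dag-n20-d); (e) for EVERY letter `Z : ℕ → ℝ → ℝ` the extraction body «`0 < l₀ ∧ 0 < vol ∧ Z (K₀+K) t = Σ_T A ∧ Z (K₀+K+1) t
= Σ_T B` on `|t| ≤ l₀`» at `cr` and at `cr♯` is ONE proposition; (f) `∃ δ, Core l₀ vol T Bad (A − shA) (B − shB) δ ∧ Summable δ` at `cr` ⇒ at `cr♯` (same `δ`).
[cite: King1986, (3.10)–(3.13) pp.656–657; Balaban1989LargeFieldII, (1.80) p.384 (bookkeeping)] -/
theorem exists_foldedPair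
    (jc : (F : T4Family) → (θ : Stage13HParams F N) → θ.Provisos₁₃CoPH F N → (ℕ → ℝ) → List (ULoop F) → ℕ → ℕ)
    (sh : ShellSplit₁₃CoPH N 0) (cr : SpineReading₁₃CoPH N)
    (hpin : ∀ (F : T4Family) (θ : Stage13HParams F N) (hP : θ.Provisos₁₃CoPH F N) (g₀ : ℕ → ℝ) (os : List (ULoop F)),
      Live F θ → cr F θ hP g₀ os = crOfRecord₁₃V (jc F θ hP g₀ os) sh F θ hP g₀ os) :
    ∃ (shS : ShellSplit₁₃CoPH N 0) (crS : SpineReading₁₃CoPH N),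
      (∀ (F : T4Family) (θ : Stage13HParams F N) (hP : θ.Provisos₁₃CoPH F N) (g₀ : ℕ → ℝ) (os : List (ULoop F)),
          Live F θ → crS F θ hP g₀ os = crOfRecord₁₃V (fun _ => 0) shS F θ hP g₀ os) ∧
      (∀ (F : T4Family) (θ : Stage13HParams F N) (hP : θ.Provisos₁₃CoPH F N) (g₀ : ℕ → ℝ) (os : List (ULoop F)),
          ¬ Live F θ → crS F θ hP g₀ os = cr F θ hP g₀ os) ∧
      (∀ (F : T4Family) (θ : Stage13HParams F N) (hP : θ.Provisos₁₃CoPH F N) (g₀ : ℕ → ℝ) (os : List (ULoop F)),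
          Live F θ → RelWeightBound (crS F θ hP g₀ os).l₀ (crS F θ hP g₀ os).T (crS F θ hP g₀ os).A (crS F θ hP g₀ os).B (crS F θ hP g₀ os).Bad (crS F θ hP g₀ os).W) ∧
      (∀ (F : T4Family) (θ : Stage13HParams F N) (hP : θ.Provisos₁₃CoPH F N) (g₀ : ℕ → ℝ) (os : List (ULoop F)),
          RelWeightBound (cr F θ hP g₀ os).l₀ (cr F θ hP g₀ os).T (cr F θ hP g₀ os).A (cr F θ hP g₀ os).B (cr F θ hP g₀ os).Bad (cr F θ hP g₀ os).W →
          RelWeightBound (crS F θ hP g₀ os).l₀ (crS F θ hP g₀ os).T (crS F θ hP g₀ os).A (crS F θ hP g₀ os).B (crS F θ hP g₀ os).Bad (crS F θ hP g₀ os).W) ∧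
      (∀ (F : T4Family) (θ : Stage13HParams F N) (hP : θ.Provisos₁₃CoPH F N) (g₀ : ℕ → ℝ) (os : List (ULoop F)),
          RelWeightBound (cr F θ hP g₀ os).l₀ (cr F θ hP g₀ os).T (cr F θ hP g₀ os).A (cr F θ hP g₀ os).B (cr F θ hP g₀ os).Bad (cr F θ hP g₀ os).W →
          ShellWeightBound (cr F θ hP g₀ os).l₀ (cr F θ hP g₀ os).T (cr F θ hP g₀ os).A (cr F θ hP g₀ os).B (cr F θ hP g₀ os).shA (cr F θ hP g₀ os).shB
            (cr F θ hP g₀ os).Wsh →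
          ShellWeightBound (crS F θ hP g₀ os).l₀ (crS F θ hP g₀ os).T (crS F θ hP g₀ os).A (crS F θ hP g₀ os).B (crS F θ hP g₀ os).shA (crS F θ hP g₀ os).shB
            (crS F θ hP g₀ os).Wsh) ∧
      (∀ (F : T4Family) (θ : Stage13HParams F N) (hP : θ.Provisos₁₃CoPH F N) (g₀ : ℕ → ℝ) (os : List (ULoop F)) (Z : ℕ → ℝ → ℝ),
          (0 < (cr F θ hP g₀ os).l₀ ∧ 0 < (cr F θ hP g₀ os).vol ∧
            (∀ (K : ℕ) (t : ℝ), |t| ≤ (cr F θ hP g₀ os).l₀ → Z ((cr F θ hP g₀ os).K₀ + K) t = ∑ τ ∈ (cr F θ hP g₀ os).T K, (cr F θ hP g₀ os).A K t τ) ∧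
            (∀ (K : ℕ) (t : ℝ), |t| ≤ (cr F θ hP g₀ os).l₀ → Z ((cr F θ hP g₀ os).K₀ + K + 1) t = ∑ τ ∈ (cr F θ hP g₀ os).T K, (cr F θ hP g₀ os).B K t τ)) ↔
          (0 < (crS F θ hP g₀ os).l₀ ∧ 0 < (crS F θ hP g₀ os).vol ∧
            (∀ (K : ℕ) (t : ℝ), |t| ≤ (crS F θ hP g₀ os).l₀ → Z ((crS F θ hP g₀ os).K₀ + K) t = ∑ τ ∈ (crS F θ hP g₀ os).T K, (crS F θ hP g₀ os).A K t τ) ∧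
            (∀ (K : ℕ) (t : ℝ), |t| ≤ (crS F θ hP g₀ os).l₀ → Z ((crS F θ hP g₀ os).K₀ + K + 1) t = ∑ τ ∈ (crS F θ hP g₀ os).T K, (crS F θ hP g₀ os).B K t τ))) ∧
      (∀ (F : T4Family) (θ : Stage13HParams F N) (hP : θ.Provisos₁₃CoPH F N) (g₀ : ℕ → ℝ) (os : List (ULoop F)),
          (letI := (cr F θ hP g₀ os).dec
           ∃ δ : ℕ → ℝ, NE7.Core (cr F θ hP g₀ os).l₀ (cr F θ hP g₀ os).vol (cr F θ hP g₀ os).T (cr F θ hP g₀ os).Bad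
              (fun K t τ => (cr F θ hP g₀ os).A K t τ - (cr F θ hP g₀ os).shA K t τ) (fun K t τ => (cr F θ hP g₀ os).B K t τ - (cr F θ hP g₀ os).shB K t τ) δ ∧
              Summable δ) →
          (letI := (crS F θ hP g₀ os).dec
           ∃ δ : ℕ → ℝ, NE7.Core (crS F θ hP g₀ os).l₀ (crS F θ hP g₀ os).vol (crS F θ hP g₀ os).T (crS F θ hP g₀ os).Bad
              (fun K t τ => (crS F θ hP g₀ os).A K t τ - (crS F θ hP g₀ os).shA K t τ) (fun K t τ => (crS F θ hP g₀ os).B K t τ - (crS F θ hP g₀ os).shB K t τ) δ ∧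
              Summable δ)) := by
  classical
  -- the folded split: the whole class weight on the `jc`-bad keys, `sh` off them (dag-n19-w1's fold equations, at every tuple)
  let shS : ShellSplit₁₃CoPH N 0 := fun F θ hP g₀ os =>
    (fun K t x => if x ∈ badClass₁₃ θ 0 g₀ (jc F θ hP g₀ os) K t then weightA₁₃ θ hP 0 g₀ os K t x else (sh F θ hP g₀ os).1 K t x,
     fun K t x => if x ∈ badClass₁₃ θ 0 g₀ (jc F θ hP g₀ os) K t then weightB₁₃ θ hP 0 g₀ os K t x else (sh F θ hP g₀ os).2 K t x)
  -- the folded reading: the zero-cut reading of record ON the live line, the given reading OFF it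
  let crS : SpineReading₁₃CoPH N := fun F θ hP g₀ os => if Live F θ then crOfRecord₁₃V (fun _ => 0) shS F θ hP g₀ os else cr F θ hP g₀ os
  have hon : ∀ (F : T4Family) (θ : Stage13HParams F N) (hP : θ.Provisos₁₃CoPH F N) (g₀ : ℕ → ℝ) (os : List (ULoop F)),
      Live F θ → crS F θ hP g₀ os = crOfRecord₁₃VAt 0 (fun _ => 0) shS F θ hP g₀ os := fun F θ hP g₀ os hL => if_pos hL
  have hoff : ∀ (F : T4Family) (θ : Stage13HParams F N) (hP : θ.Provisos₁₃CoPH F N) (g₀ : ℕ → ℝ) (os : List (ULoop F)),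
      ¬ Live F θ → crS F θ hP g₀ os = cr F θ hP g₀ os := fun F θ hP g₀ os hL => if_neg hL
  have hpin' : ∀ (F : T4Family) (θ : Stage13HParams F N) (hP : θ.Provisos₁₃CoPH F N) (g₀ : ℕ → ℝ) (os : List (ULoop F)),
      Live F θ → cr F θ hP g₀ os = crOfRecord₁₃VAt 0 (jc F θ hP g₀ os) sh F θ hP g₀ os := fun F θ hP g₀ os hL => hpin F θ hP g₀ os hL
  have hfold₁ : ∀ (F : T4Family) (θ : Stage13HParams F N) (hP : θ.Provisos₁₃CoPH F N) (g₀ : ℕ → ℝ) (os : List (ULoop F)),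
      letI : DecidableEq (Σ K, SiteSeqKey F (0 + K)) := Classical.decEq _
      ∀ (K : ℕ) (t : ℝ) (x : Σ K, SiteSeqKey F (0 + K)),
        (shS F θ hP g₀ os).1 K t x = if x ∈ badClass₁₃ θ 0 g₀ (jc F θ hP g₀ os) K t then weightA₁₃ θ hP 0 g₀ os K t x else (sh F θ hP g₀ os).1 K t x := by
    intro F θ hP g₀ os K t x
    show (if x ∈ badClass₁₃ θ 0 g₀ (jc F θ hP g₀ os) K t then weightA₁₃ θ hP 0 g₀ os K t x else (sh F θ hP g₀ os).1 K t x) = _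
    split_ifs <;> rfl
  have hfold₂ : ∀ (F : T4Family) (θ : Stage13HParams F N) (hP : θ.Provisos₁₃CoPH F N) (g₀ : ℕ → ℝ) (os : List (ULoop F)),
      letI : DecidableEq (Σ K, SiteSeqKey F (0 + K)) := Classical.decEq _
      ∀ (K : ℕ) (t : ℝ) (x : Σ K, SiteSeqKey F (0 + K)),
        (shS F θ hP g₀ os).2 K t x = if x ∈ badClass₁₃ θ 0 g₀ (jc F θ hP g₀ os) K t then weightB₁₃ θ hP 0 g₀ os K t x else (sh F θ hP g₀ os).2 K t x := by
    intro F θ hP g₀ os K t x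
    show (if x ∈ badClass₁₃ θ 0 g₀ (jc F θ hP g₀ os) K t then weightB₁₃ θ hP 0 g₀ os K t x else (sh F θ hP g₀ os).2 K t x) = _
    split_ifs <;> rfl
  refine ⟨shS, crS, fun F θ hP g₀ os hL => hon F θ hP g₀ os hL, hoff, ?_, ?_, ?_, ?_, ?_⟩
  · -- (c) N20 free at the zero cut ON the live line
    intro F θ hP g₀ os hL
    rw [hon F θ hP g₀ os hL]
    exact relWeightBound_crOfRecord₁₃VAt_cutZero 0 θ hP g₀ os shS
  · -- (c′) N20 inherited everywhere
    intro F θ hP g₀ os h20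
    by_cases hL : Live F θ
    · rw [hon F θ hP g₀ os hL]
      exact relWeightBound_crOfRecord₁₃VAt_cutZero 0 θ hP g₀ os shS
    · rw [hoff F θ hP g₀ os hL]
      exact h20
  · -- (d) N21: the budget-free fold ON the live line
    intro F θ hP g₀ os h20 h21
    by_cases hL : Live F θ
    · rw [hon F θ hP g₀ os hL]
      rw [hpin' F θ hP g₀ os hL] at h20 h21
      exact shellWeightBound_crOfRecord₁₃VAt_cutZero_of_faces 0 (jc F θ hP g₀ os) sh shS θ hP g₀ os (hfold₁ F θ hP g₀ os) (hfold₂ F θ hP g₀ os) h20 h21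
    · rw [hoff F θ hP g₀ os hL]
      exact h21
  · -- (e) N27x: the extraction body does not read the cut or the split, whatever the partition-function letter
    intro F θ hP g₀ os Z
    by_cases hL : Live F θ
    · rw [hon F θ hP g₀ os hL, hpin' F θ hP g₀ os hL]
      exact extraction_crOfRecord₁₃VAt_iff 0 (jc F θ hP g₀ os) sh shS θ hP g₀ os Z
    · rw [hoff F θ hP g₀ os hL]
  · -- (f) N19′: the same `δ` after the fold
    intro F θ hP g₀ os h19
    by_cases hL : Live F θ
    · rw [hon F θ hP g₀ os hL]
      rw [hpin' F θ hP g₀ os hL] at h19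
      exact coreEdge_crOfRecord₁₃VAt_cutZero_of_coreEdge 0 (jc F θ hP g₀ os) sh shS θ hP g₀ os (hfold₁ F θ hP g₀ os) (hfold₂ F θ hP g₀ os) h19
    · rw [hoff F θ hP g₀ os hL]
      exact h19

end Package

/-! ## §2  The v6-shaped stub-2 body: any witness folds to a zero-cut witness (shapes of K3⁸ v6 spelled out, generic letters) -/

section BodyV

variable (Live G : (F : T4Family) → Stage13HParams F N → Prop)
  (PremV : (F : T4Family) → (θ : Stage13HParams F N) → (h : θ.Provisos₁₃SepCoPH F N) → Revision₁₃ F N θ h → (ℕ → ℝ) → List (ULoop F) → Prop)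

/-- ★★ **ANY v6-SHAPED STUB-2 WITNESS FOLDS TO A ZERO-CUT WITNESS** [bookkeeping].  Shapes (skeleton v6 b4e55110ab73e679 ∕ dag-n27-w1's `K3V6Defs`, spelled out; `S := cr F θ hP g₀ os`):
`PinnedAtLive jc sh cr` = «`Live F θ → S = crOfRecord₁₃V (jc F θ hP g₀ os) sh F θ hP g₀ os`»; `KeyedRelWeight cr` = «guard → admissible → ∀ g₀ os, `RelWeightBound S.l₀ S.T S.A S.B S.Bad S.W`»;
`KeyedShellWeight cr` likewise with `ShellWeightBound … S.shA S.shB S.Wsh` (all three v5's, keyed on the CORE provisos); `KeyedExtractionV cr` ∕ `KeyedCoreEdgeHolderD4V β cr rr` under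
«`∀ (h : θ.Provisos₁₃SepCoPH F N) (v : Revision₁₃ F N θ h)`, guard → admissible → (B)(`datumOfRecord₁₃SepCoPHV F N θ h v`) → END(same) → `ForSmallCouplings (datumOfRecord₁₃SepCoPHV F N θ h v)`»,
the extraction rows reading the SLOT datum's Wilson schemes and the reading at `h.toCore`, the core edge under the slot-keyed rates premise `PremV F θ h v g₀ os`.  The folded pair of §1
witnesses the zero-cut body (prefix pushed by `ForSmallCouplings.mono`). [cite: Balaban1987RG1, Thm 2 p.259; King1986, (3.10)–(3.13) pp.656–657 (bookkeeping)] -/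
theorem exists_zeroCut_of_existsV
    (h : ∃ (jc : (F : T4Family) → (θ : Stage13HParams F N) → θ.Provisos₁₃CoPH F N → (ℕ → ℝ) → List (ULoop F) → ℕ → ℕ)
        (sh : ShellSplit₁₃CoPH N 0) (cr : SpineReading₁₃CoPH N),
      (∀ (F : T4Family) (θ : Stage13HParams F N) (hP : θ.Provisos₁₃CoPH F N) (g₀ : ℕ → ℝ) (os : List (ULoop F)),
          Live F θ → cr F θ hP g₀ os = crOfRecord₁₃V (jc F θ hP g₀ os) sh F θ hP g₀ os) ∧
      (∀ (F : T4Family) (θ : Stage13HParams F N) (hP : θ.Provisos₁₃CoPH F N), G F θ → θ.Admissible F N → ∀ (g₀ : ℕ → ℝ) (os : List (ULoop F)),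
          RelWeightBound (cr F θ hP g₀ os).l₀ (cr F θ hP g₀ os).T (cr F θ hP g₀ os).A (cr F θ hP g₀ os).B (cr F θ hP g₀ os).Bad (cr F θ hP g₀ os).W) ∧
      (∀ (F : T4Family) (θ : Stage13HParams F N) (hP : θ.Provisos₁₃CoPH F N), G F θ → θ.Admissible F N → ∀ (g₀ : ℕ → ℝ) (os : List (ULoop F)),
          ShellWeightBound (cr F θ hP g₀ os).l₀ (cr F θ hP g₀ os).T (cr F θ hP g₀ os).A (cr F θ hP g₀ os).B (cr F θ hP g₀ os).shA (cr F θ hP g₀ os).shB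
            (cr F θ hP g₀ os).Wsh) ∧
      (∀ (F : T4Family) (θ : Stage13HParams F N) (h : θ.Provisos₁₃SepCoPH F N) (v : Revision₁₃ F N θ h), G F θ → θ.Admissible F N →
          B16.EndStatementBPrinted (datumOfRecord₁₃SepCoPHV F N θ h v).C → DagBinding.EndpointExistence (datumOfRecord₁₃SepCoPHV F N θ h v).C.toB12 →
            ForSmallCouplings (datumOfRecord₁₃SepCoPHV F N θ h v) fun g₀ => ∀ os : List (ULoop F),
              0 < (cr F θ h.toCore g₀ os).l₀ ∧ 0 < (cr F θ h.toCore g₀ os).vol ∧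
              (∀ (K : ℕ) (t : ℝ), |t| ≤ (cr F θ h.toCore g₀ os).l₀ →
                T4GenFunBounds.schemeZ ((datumOfRecord₁₃SepCoPHV F N θ h v).scheme g₀) os ((cr F θ h.toCore g₀ os).K₀ + K) t =
                  ∑ τ ∈ (cr F θ h.toCore g₀ os).T K, (cr F θ h.toCore g₀ os).A K t τ) ∧
              (∀ (K : ℕ) (t : ℝ), |t| ≤ (cr F θ h.toCore g₀ os).l₀ →
                T4GenFunBounds.schemeZ ((datumOfRecord₁₃SepCoPHV F N θ h v).scheme g₀) os ((cr F θ h.toCore g₀ os).K₀ + K + 1) t =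
                  ∑ τ ∈ (cr F θ h.toCore g₀ os).T K, (cr F θ h.toCore g₀ os).B K t τ)) ∧
      (∀ (F : T4Family) (θ : Stage13HParams F N) (h : θ.Provisos₁₃SepCoPH F N) (v : Revision₁₃ F N θ h), G F θ → θ.Admissible F N →
          B16.EndStatementBPrinted (datumOfRecord₁₃SepCoPHV F N θ h v).C → DagBinding.EndpointExistence (datumOfRecord₁₃SepCoPHV F N θ h v).C.toB12 →
            ForSmallCouplings (datumOfRecord₁₃SepCoPHV F N θ h v) fun g₀ => ∀ os : List (ULoop F),
              PremV F θ h v g₀ os → letI := (cr F θ h.toCore g₀ os).dec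
                ∃ δ : ℕ → ℝ, NE7.Core (cr F θ h.toCore g₀ os).l₀ (cr F θ h.toCore g₀ os).vol (cr F θ h.toCore g₀ os).T (cr F θ h.toCore g₀ os).Bad
                  (fun K t τ => (cr F θ h.toCore g₀ os).A K t τ - (cr F θ h.toCore g₀ os).shA K t τ)
                  (fun K t τ => (cr F θ h.toCore g₀ os).B K t τ - (cr F θ h.toCore g₀ os).shB K t τ) δ ∧ Summable δ)) :
    ∃ (sh : ShellSplit₁₃CoPH N 0) (cr : SpineReading₁₃CoPH N),
      (∀ (F : T4Family) (θ : Stage13HParams F N) (hP : θ.Provisos₁₃CoPH F N) (g₀ : ℕ → ℝ) (os : List (ULoop F)),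
          Live F θ → cr F θ hP g₀ os = crOfRecord₁₃V (fun _ => 0) sh F θ hP g₀ os) ∧
      (∀ (F : T4Family) (θ : Stage13HParams F N) (hP : θ.Provisos₁₃CoPH F N), G F θ → θ.Admissible F N → ∀ (g₀ : ℕ → ℝ) (os : List (ULoop F)),
          RelWeightBound (cr F θ hP g₀ os).l₀ (cr F θ hP g₀ os).T (cr F θ hP g₀ os).A (cr F θ hP g₀ os).B (cr F θ hP g₀ os).Bad (cr F θ hP g₀ os).W) ∧
      (∀ (F : T4Family) (θ : Stage13HParams F N) (hP : θ.Provisos₁₃CoPH F N), G F θ → θ.Admissible F N → ∀ (g₀ : ℕ → ℝ) (os : List (ULoop F)),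
          ShellWeightBound (cr F θ hP g₀ os).l₀ (cr F θ hP g₀ os).T (cr F θ hP g₀ os).A (cr F θ hP g₀ os).B (cr F θ hP g₀ os).shA (cr F θ hP g₀ os).shB
            (cr F θ hP g₀ os).Wsh) ∧
      (∀ (F : T4Family) (θ : Stage13HParams F N) (h : θ.Provisos₁₃SepCoPH F N) (v : Revision₁₃ F N θ h), G F θ → θ.Admissible F N →
          B16.EndStatementBPrinted (datumOfRecord₁₃SepCoPHV F N θ h v).C → DagBinding.EndpointExistence (datumOfRecord₁₃SepCoPHV F N θ h v).C.toB12 →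
            ForSmallCouplings (datumOfRecord₁₃SepCoPHV F N θ h v) fun g₀ => ∀ os : List (ULoop F),
              0 < (cr F θ h.toCore g₀ os).l₀ ∧ 0 < (cr F θ h.toCore g₀ os).vol ∧
              (∀ (K : ℕ) (t : ℝ), |t| ≤ (cr F θ h.toCore g₀ os).l₀ →
                T4GenFunBounds.schemeZ ((datumOfRecord₁₃SepCoPHV F N θ h v).scheme g₀) os ((cr F θ h.toCore g₀ os).K₀ + K) t =
                  ∑ τ ∈ (cr F θ h.toCore g₀ os).T K, (cr F θ h.toCore g₀ os).A K t τ) ∧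
              (∀ (K : ℕ) (t : ℝ), |t| ≤ (cr F θ h.toCore g₀ os).l₀ →
                T4GenFunBounds.schemeZ ((datumOfRecord₁₃SepCoPHV F N θ h v).scheme g₀) os ((cr F θ h.toCore g₀ os).K₀ + K + 1) t =
                  ∑ τ ∈ (cr F θ h.toCore g₀ os).T K, (cr F θ h.toCore g₀ os).B K t τ)) ∧
      (∀ (F : T4Family) (θ : Stage13HParams F N) (h : θ.Provisos₁₃SepCoPH F N) (v : Revision₁₃ F N θ h), G F θ → θ.Admissible F N →
          B16.EndStatementBPrinted (datumOfRecord₁₃SepCoPHV F N θ h v).C → DagBinding.EndpointExistence (datumOfRecord₁₃SepCoPHV F N θ h v).C.toB12 →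
            ForSmallCouplings (datumOfRecord₁₃SepCoPHV F N θ h v) fun g₀ => ∀ os : List (ULoop F),
              PremV F θ h v g₀ os → letI := (cr F θ h.toCore g₀ os).dec
                ∃ δ : ℕ → ℝ, NE7.Core (cr F θ h.toCore g₀ os).l₀ (cr F θ h.toCore g₀ os).vol (cr F θ h.toCore g₀ os).T (cr F θ h.toCore g₀ os).Bad
                  (fun K t τ => (cr F θ h.toCore g₀ os).A K t τ - (cr F θ h.toCore g₀ os).shA K t τ)
                  (fun K t τ => (cr F θ h.toCore g₀ os).B K t τ - (cr F θ h.toCore g₀ os).shB K t τ) δ ∧ Summable δ) := by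
  obtain ⟨jc, sh, cr, hpin, h20, h21, hx, h19⟩ := h
  obtain ⟨shS, crS, hon, -, -, hc', hd, he, hf⟩ := exists_foldedPair Live jc sh cr hpin
  refine ⟨shS, crS, hon, fun F θ hP hG hθ g₀ os => hc' F θ hP g₀ os (h20 F θ hP hG hθ g₀ os),
    fun F θ hP hG hθ g₀ os => hd F θ hP g₀ os (h20 F θ hP hG hθ g₀ os) (h21 F θ hP hG hθ g₀ os), ?_, ?_⟩
  · -- N27x at the slot: the extraction body with the SLOT datum's Wilson schemes as the letter `Z`
    intro F θ h v hG hθ hB hE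
    exact ForSmallCouplings.mono
      (fun g₀ hg os => (he F θ h.toCore g₀ os (fun k t => T4GenFunBounds.schemeZ ((datumOfRecord₁₃SepCoPHV F N θ h v).scheme g₀) os k t)).1 (hg os))
      (hx F θ h v hG hθ hB hE)
  · -- N19′ at the slot: the same `δ` after the fold, under the slot prefix and the slot-keyed premise
    intro F θ h v hG hθ hB hE
    exact ForSmallCouplings.mono (fun g₀ hg os hprem => hf F θ h.toCore g₀ os (hg os hprem)) (h19 F θ h v hG hθ hB hE)

/-- **THE ZERO CUT READING IS A CUT READING** (the trivial direction, v6 shapes). [bookkeeping] -/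
theorem exists_of_exists_zeroCutV
    (h : ∃ (sh : ShellSplit₁₃CoPH N 0) (cr : SpineReading₁₃CoPH N),
      (∀ (F : T4Family) (θ : Stage13HParams F N) (hP : θ.Provisos₁₃CoPH F N) (g₀ : ℕ → ℝ) (os : List (ULoop F)),
          Live F θ → cr F θ hP g₀ os = crOfRecord₁₃V (fun _ => 0) sh F θ hP g₀ os) ∧
      (∀ (F : T4Family) (θ : Stage13HParams F N) (hP : θ.Provisos₁₃CoPH F N), G F θ → θ.Admissible F N → ∀ (g₀ : ℕ → ℝ) (os : List (ULoop F)),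
          RelWeightBound (cr F θ hP g₀ os).l₀ (cr F θ hP g₀ os).T (cr F θ hP g₀ os).A (cr F θ hP g₀ os).B (cr F θ hP g₀ os).Bad (cr F θ hP g₀ os).W) ∧
      (∀ (F : T4Family) (θ : Stage13HParams F N) (hP : θ.Provisos₁₃CoPH F N), G F θ → θ.Admissible F N → ∀ (g₀ : ℕ → ℝ) (os : List (ULoop F)),
          ShellWeightBound (cr F θ hP g₀ os).l₀ (cr F θ hP g₀ os).T (cr F θ hP g₀ os).A (cr F θ hP g₀ os).B (cr F θ hP g₀ os).shA (cr F θ hP g₀ os).shB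
            (cr F θ hP g₀ os).Wsh) ∧
      (∀ (F : T4Family) (θ : Stage13HParams F N) (h : θ.Provisos₁₃SepCoPH F N) (v : Revision₁₃ F N θ h), G F θ → θ.Admissible F N →
          B16.EndStatementBPrinted (datumOfRecord₁₃SepCoPHV F N θ h v).C → DagBinding.EndpointExistence (datumOfRecord₁₃SepCoPHV F N θ h v).C.toB12 →
            ForSmallCouplings (datumOfRecord₁₃SepCoPHV F N θ h v) fun g₀ => ∀ os : List (ULoop F),
              0 < (cr F θ h.toCore g₀ os).l₀ ∧ 0 < (cr F θ h.toCore g₀ os).vol ∧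
              (∀ (K : ℕ) (t : ℝ), |t| ≤ (cr F θ h.toCore g₀ os).l₀ →
                T4GenFunBounds.schemeZ ((datumOfRecord₁₃SepCoPHV F N θ h v).scheme g₀) os ((cr F θ h.toCore g₀ os).K₀ + K) t =
                  ∑ τ ∈ (cr F θ h.toCore g₀ os).T K, (cr F θ h.toCore g₀ os).A K t τ) ∧
              (∀ (K : ℕ) (t : ℝ), |t| ≤ (cr F θ h.toCore g₀ os).l₀ →
                T4GenFunBounds.schemeZ ((datumOfRecord₁₃SepCoPHV F N θ h v).scheme g₀) os ((cr F θ h.toCore g₀ os).K₀ + K + 1) t =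
                  ∑ τ ∈ (cr F θ h.toCore g₀ os).T K, (cr F θ h.toCore g₀ os).B K t τ)) ∧
      (∀ (F : T4Family) (θ : Stage13HParams F N) (h : θ.Provisos₁₃SepCoPH F N) (v : Revision₁₃ F N θ h), G F θ → θ.Admissible F N →
          B16.EndStatementBPrinted (datumOfRecord₁₃SepCoPHV F N θ h v).C → DagBinding.EndpointExistence (datumOfRecord₁₃SepCoPHV F N θ h v).C.toB12 →
            ForSmallCouplings (datumOfRecord₁₃SepCoPHV F N θ h v) fun g₀ => ∀ os : List (ULoop F),
              PremV F θ h v g₀ os → letI := (cr F θ h.toCore g₀ os).dec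
                ∃ δ : ℕ → ℝ, NE7.Core (cr F θ h.toCore g₀ os).l₀ (cr F θ h.toCore g₀ os).vol (cr F θ h.toCore g₀ os).T (cr F θ h.toCore g₀ os).Bad
                  (fun K t τ => (cr F θ h.toCore g₀ os).A K t τ - (cr F θ h.toCore g₀ os).shA K t τ)
                  (fun K t τ => (cr F θ h.toCore g₀ os).B K t τ - (cr F θ h.toCore g₀ os).shB K t τ) δ ∧ Summable δ)) :
    ∃ (jc : (F : T4Family) → (θ : Stage13HParams F N) → θ.Provisos₁₃CoPH F N → (ℕ → ℝ) → List (ULoop F) → ℕ → ℕ)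
        (sh : ShellSplit₁₃CoPH N 0) (cr : SpineReading₁₃CoPH N),
      (∀ (F : T4Family) (θ : Stage13HParams F N) (hP : θ.Provisos₁₃CoPH F N) (g₀ : ℕ → ℝ) (os : List (ULoop F)),
          Live F θ → cr F θ hP g₀ os = crOfRecord₁₃V (jc F θ hP g₀ os) sh F θ hP g₀ os) ∧
      (∀ (F : T4Family) (θ : Stage13HParams F N) (hP : θ.Provisos₁₃CoPH F N), G F θ → θ.Admissible F N → ∀ (g₀ : ℕ → ℝ) (os : List (ULoop F)),
          RelWeightBound (cr F θ hP g₀ os).l₀ (cr F θ hP g₀ os).T (cr F θ hP g₀ os).A (cr F θ hP g₀ os).B (cr F θ hP g₀ os).Bad (cr F θ hP g₀ os).W) ∧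
      (∀ (F : T4Family) (θ : Stage13HParams F N) (hP : θ.Provisos₁₃CoPH F N), G F θ → θ.Admissible F N → ∀ (g₀ : ℕ → ℝ) (os : List (ULoop F)),
          ShellWeightBound (cr F θ hP g₀ os).l₀ (cr F θ hP g₀ os).T (cr F θ hP g₀ os).A (cr F θ hP g₀ os).B (cr F θ hP g₀ os).shA (cr F θ hP g₀ os).shB
            (cr F θ hP g₀ os).Wsh) ∧
      (∀ (F : T4Family) (θ : Stage13HParams F N) (h : θ.Provisos₁₃SepCoPH F N) (v : Revision₁₃ F N θ h), G F θ → θ.Admissible F N →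
          B16.EndStatementBPrinted (datumOfRecord₁₃SepCoPHV F N θ h v).C → DagBinding.EndpointExistence (datumOfRecord₁₃SepCoPHV F N θ h v).C.toB12 →
            ForSmallCouplings (datumOfRecord₁₃SepCoPHV F N θ h v) fun g₀ => ∀ os : List (ULoop F),
              0 < (cr F θ h.toCore g₀ os).l₀ ∧ 0 < (cr F θ h.toCore g₀ os).vol ∧
              (∀ (K : ℕ) (t : ℝ), |t| ≤ (cr F θ h.toCore g₀ os).l₀ →
                T4GenFunBounds.schemeZ ((datumOfRecord₁₃SepCoPHV F N θ h v).scheme g₀) os ((cr F θ h.toCore g₀ os).K₀ + K) t =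
                  ∑ τ ∈ (cr F θ h.toCore g₀ os).T K, (cr F θ h.toCore g₀ os).A K t τ) ∧
              (∀ (K : ℕ) (t : ℝ), |t| ≤ (cr F θ h.toCore g₀ os).l₀ →
                T4GenFunBounds.schemeZ ((datumOfRecord₁₃SepCoPHV F N θ h v).scheme g₀) os ((cr F θ h.toCore g₀ os).K₀ + K + 1) t =
                  ∑ τ ∈ (cr F θ h.toCore g₀ os).T K, (cr F θ h.toCore g₀ os).B K t τ)) ∧
      (∀ (F : T4Family) (θ : Stage13HParams F N) (h : θ.Provisos₁₃SepCoPH F N) (v : Revision₁₃ F N θ h), G F θ → θ.Admissible F N →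
          B16.EndStatementBPrinted (datumOfRecord₁₃SepCoPHV F N θ h v).C → DagBinding.EndpointExistence (datumOfRecord₁₃SepCoPHV F N θ h v).C.toB12 →
            ForSmallCouplings (datumOfRecord₁₃SepCoPHV F N θ h v) fun g₀ => ∀ os : List (ULoop F),
              PremV F θ h v g₀ os → letI := (cr F θ h.toCore g₀ os).dec
                ∃ δ : ℕ → ℝ, NE7.Core (cr F θ h.toCore g₀ os).l₀ (cr F θ h.toCore g₀ os).vol (cr F θ h.toCore g₀ os).T (cr F θ h.toCore g₀ os).Bad
                  (fun K t τ => (cr F θ h.toCore g₀ os).A K t τ - (cr F θ h.toCore g₀ os).shA K t τ)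
                  (fun K t τ => (cr F θ h.toCore g₀ os).B K t τ - (cr F θ h.toCore g₀ os).shB K t τ) δ ∧ Summable δ) := by
  obtain ⟨sh, cr, hpin, h20, h21, hx, h19⟩ := h
  exact ⟨fun _ _ _ _ _ _ => 0, sh, cr, hpin, h20, h21, hx, h19⟩

/-- ★★ **THE CUT DIAL OF K3⁸ v6's STUB 2 IS ELIMINABLE** [bookkeeping]: the v6-shaped stub-2 body (spelled out, generic letters) is EQUIVALENT to its zero-cut specialisation.
[cite: Balaban1989LargeFieldII, (1.80) p.384; King1986, (3.10)–(3.13) pp.656–657 (bookkeeping)] -/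
theorem stubTwoBodyV_iff_zeroCut :
    (∃ (jc : (F : T4Family) → (θ : Stage13HParams F N) → θ.Provisos₁₃CoPH F N → (ℕ → ℝ) → List (ULoop F) → ℕ → ℕ)
        (sh : ShellSplit₁₃CoPH N 0) (cr : SpineReading₁₃CoPH N),
      (∀ (F : T4Family) (θ : Stage13HParams F N) (hP : θ.Provisos₁₃CoPH F N) (g₀ : ℕ → ℝ) (os : List (ULoop F)),
          Live F θ → cr F θ hP g₀ os = crOfRecord₁₃V (jc F θ hP g₀ os) sh F θ hP g₀ os) ∧
      (∀ (F : T4Family) (θ : Stage13HParams F N) (hP : θ.Provisos₁₃CoPH F N), G F θ → θ.Admissible F N → ∀ (g₀ : ℕ → ℝ) (os : List (ULoop F)),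
          RelWeightBound (cr F θ hP g₀ os).l₀ (cr F θ hP g₀ os).T (cr F θ hP g₀ os).A (cr F θ hP g₀ os).B (cr F θ hP g₀ os).Bad (cr F θ hP g₀ os).W) ∧
      (∀ (F : T4Family) (θ : Stage13HParams F N) (hP : θ.Provisos₁₃CoPH F N), G F θ → θ.Admissible F N → ∀ (g₀ : ℕ → ℝ) (os : List (ULoop F)),
          ShellWeightBound (cr F θ hP g₀ os).l₀ (cr F θ hP g₀ os).T (cr F θ hP g₀ os).A (cr F θ hP g₀ os).B (cr F θ hP g₀ os).shA (cr F θ hP g₀ os).shB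
            (cr F θ hP g₀ os).Wsh) ∧
      (∀ (F : T4Family) (θ : Stage13HParams F N) (h : θ.Provisos₁₃SepCoPH F N) (v : Revision₁₃ F N θ h), G F θ → θ.Admissible F N →
          B16.EndStatementBPrinted (datumOfRecord₁₃SepCoPHV F N θ h v).C → DagBinding.EndpointExistence (datumOfRecord₁₃SepCoPHV F N θ h v).C.toB12 →
            ForSmallCouplings (datumOfRecord₁₃SepCoPHV F N θ h v) fun g₀ => ∀ os : List (ULoop F),
              0 < (cr F θ h.toCore g₀ os).l₀ ∧ 0 < (cr F θ h.toCore g₀ os).vol ∧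
              (∀ (K : ℕ) (t : ℝ), |t| ≤ (cr F θ h.toCore g₀ os).l₀ →
                T4GenFunBounds.schemeZ ((datumOfRecord₁₃SepCoPHV F N θ h v).scheme g₀) os ((cr F θ h.toCore g₀ os).K₀ + K) t =
                  ∑ τ ∈ (cr F θ h.toCore g₀ os).T K, (cr F θ h.toCore g₀ os).A K t τ) ∧
              (∀ (K : ℕ) (t : ℝ), |t| ≤ (cr F θ h.toCore g₀ os).l₀ →
                T4GenFunBounds.schemeZ ((datumOfRecord₁₃SepCoPHV F N θ h v).scheme g₀) os ((cr F θ h.toCore g₀ os).K₀ + K + 1) t =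
                  ∑ τ ∈ (cr F θ h.toCore g₀ os).T K, (cr F θ h.toCore g₀ os).B K t τ)) ∧
      (∀ (F : T4Family) (θ : Stage13HParams F N) (h : θ.Provisos₁₃SepCoPH F N) (v : Revision₁₃ F N θ h), G F θ → θ.Admissible F N →
          B16.EndStatementBPrinted (datumOfRecord₁₃SepCoPHV F N θ h v).C → DagBinding.EndpointExistence (datumOfRecord₁₃SepCoPHV F N θ h v).C.toB12 →
            ForSmallCouplings (datumOfRecord₁₃SepCoPHV F N θ h v) fun g₀ => ∀ os : List (ULoop F),
              PremV F θ h v g₀ os → letI := (cr F θ h.toCore g₀ os).dec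
                ∃ δ : ℕ → ℝ, NE7.Core (cr F θ h.toCore g₀ os).l₀ (cr F θ h.toCore g₀ os).vol (cr F θ h.toCore g₀ os).T (cr F θ h.toCore g₀ os).Bad
                  (fun K t τ => (cr F θ h.toCore g₀ os).A K t τ - (cr F θ h.toCore g₀ os).shA K t τ)
                  (fun K t τ => (cr F θ h.toCore g₀ os).B K t τ - (cr F θ h.toCore g₀ os).shB K t τ) δ ∧ Summable δ)) ↔
    ∃ (sh : ShellSplit₁₃CoPH N 0) (cr : SpineReading₁₃CoPH N),
      (∀ (F : T4Family) (θ : Stage13HParams F N) (hP : θ.Provisos₁₃CoPH F N) (g₀ : ℕ → ℝ) (os : List (ULoop F)),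
          Live F θ → cr F θ hP g₀ os = crOfRecord₁₃V (fun _ => 0) sh F θ hP g₀ os) ∧
      (∀ (F : T4Family) (θ : Stage13HParams F N) (hP : θ.Provisos₁₃CoPH F N), G F θ → θ.Admissible F N → ∀ (g₀ : ℕ → ℝ) (os : List (ULoop F)),
          RelWeightBound (cr F θ hP g₀ os).l₀ (cr F θ hP g₀ os).T (cr F θ hP g₀ os).A (cr F θ hP g₀ os).B (cr F θ hP g₀ os).Bad (cr F θ hP g₀ os).W) ∧
      (∀ (F : T4Family) (θ : Stage13HParams F N) (hP : θ.Provisos₁₃CoPH F N), G F θ → θ.Admissible F N → ∀ (g₀ : ℕ → ℝ) (os : List (ULoop F)),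
          ShellWeightBound (cr F θ hP g₀ os).l₀ (cr F θ hP g₀ os).T (cr F θ hP g₀ os).A (cr F θ hP g₀ os).B (cr F θ hP g₀ os).shA (cr F θ hP g₀ os).shB
            (cr F θ hP g₀ os).Wsh) ∧
      (∀ (F : T4Family) (θ : Stage13HParams F N) (h : θ.Provisos₁₃SepCoPH F N) (v : Revision₁₃ F N θ h), G F θ → θ.Admissible F N →
          B16.EndStatementBPrinted (datumOfRecord₁₃SepCoPHV F N θ h v).C → DagBinding.EndpointExistence (datumOfRecord₁₃SepCoPHV F N θ h v).C.toB12 →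
            ForSmallCouplings (datumOfRecord₁₃SepCoPHV F N θ h v) fun g₀ => ∀ os : List (ULoop F),
              0 < (cr F θ h.toCore g₀ os).l₀ ∧ 0 < (cr F θ h.toCore g₀ os).vol ∧
              (∀ (K : ℕ) (t : ℝ), |t| ≤ (cr F θ h.toCore g₀ os).l₀ →
                T4GenFunBounds.schemeZ ((datumOfRecord₁₃SepCoPHV F N θ h v).scheme g₀) os ((cr F θ h.toCore g₀ os).K₀ + K) t =
                  ∑ τ ∈ (cr F θ h.toCore g₀ os).T K, (cr F θ h.toCore g₀ os).A K t τ) ∧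
              (∀ (K : ℕ) (t : ℝ), |t| ≤ (cr F θ h.toCore g₀ os).l₀ →
                T4GenFunBounds.schemeZ ((datumOfRecord₁₃SepCoPHV F N θ h v).scheme g₀) os ((cr F θ h.toCore g₀ os).K₀ + K + 1) t =
                  ∑ τ ∈ (cr F θ h.toCore g₀ os).T K, (cr F θ h.toCore g₀ os).B K t τ)) ∧
      (∀ (F : T4Family) (θ : Stage13HParams F N) (h : θ.Provisos₁₃SepCoPH F N) (v : Revision₁₃ F N θ h), G F θ → θ.Admissible F N →
          B16.EndStatementBPrinted (datumOfRecord₁₃SepCoPHV F N θ h v).C → DagBinding.EndpointExistence (datumOfRecord₁₃SepCoPHV F N θ h v).C.toB12 →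
            ForSmallCouplings (datumOfRecord₁₃SepCoPHV F N θ h v) fun g₀ => ∀ os : List (ULoop F),
              PremV F θ h v g₀ os → letI := (cr F θ h.toCore g₀ os).dec
                ∃ δ : ℕ → ℝ, NE7.Core (cr F θ h.toCore g₀ os).l₀ (cr F θ h.toCore g₀ os).vol (cr F θ h.toCore g₀ os).T (cr F θ h.toCore g₀ os).Bad
                  (fun K t τ => (cr F θ h.toCore g₀ os).A K t τ - (cr F θ h.toCore g₀ os).shA K t τ)
                  (fun K t τ => (cr F θ h.toCore g₀ os).B K t τ - (cr F θ h.toCore g₀ os).shB K t τ) δ ∧ Summable δ) :=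
  ⟨exists_zeroCut_of_existsV Live G PremV, exists_of_exists_zeroCutV Live G PremV⟩

end BodyV

end Summit.QuantumFields.YangMills.BalabanUVNodes.N20CutDialFoldSlot

end
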